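import Mathlib
import Summits.Ventures.PercRepro2.SwOutCrossJunctionQThmG
import Summits.Ventures.PercRepro2.SwOutCrossJunctionSw
import Summits.Ventures.PercRepro2.SwOutCrossJunctionSwG

/-!
# Rows 2′SW-ALL and (SW) on every graph with a junction whose dropped vertices form ANY cross
graph with the inequality — in particular TWO connected components (blind cell PercRepro2,
night-4 g25, 2026-08-28; proofs/NIGHT4-G25.md §4)

The corollaries of `rigidOK_of_crossJunction'` (`reducible_of_crossJunction'`,
`swAll_of_crossJunction'`, `sw_of_crossJunction'`), and their instances for a cross graph
`G₁ ⊕g G₂` with both parts connected (`IneqAll` from `ineqM_fibKEESum₂`, the joint order):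
**`rigidOK_of_crossJunction₂`**, **`swAll_of_crossJunction₂`**, **`sw_of_crossJunction₂`** —
THEOREM A_cross FOR TWO CONNECTED DROPPED COMPONENTS AT ONE JUNCTION: rows 2′SW-ALL and (SW) on
every graph in which some vertex `u ≠ l, h` has every neighbour `h`-adjacent or a dropped vertex
of one of two connected cross-edge components.
-/

namespace Summit.Ventures.PercRepro2

namespace CrossArm

open Hull LocRows

universe uV

variable {V : Type uV} {E : Type*} [Fintype E] [DecidableEq E]

open scoped Classical

section Any

variable {ends : E → Sym2 V} {X : Type*} [Fintype X] {U : Set V} {l h o u : V} {p : X → V}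
  {G : SimpleGraph X} [DecidableRel G.Adj] {r : X}

/-- A region with a cross junction whose mark is a dropped vertex and whose cross graph has the
link inequality is a base region of the series reduction. -/
theorem CrossJunctionQ.reducible_of_crossJunction' (hj : CrossJunctionQ ends U h u p G o r)
    (hl : l ∉ U) (hineq : IneqAllQ G V r) : Reducible l h o ends U :=
  Reducible.base ends U fun ξ => hj.rigidOK_of_crossJunction' (ξ := ξ) hl hineq

/-- **Row 2′SW-ALL on every graph with a cross junction whose mark is a dropped vertex and whose
cross graph has the link inequality.** -/
theorem swAll_of_crossJunctionQ' (hlh : l ≠ h) (hj : CrossJunctionQ ends ({l}ᶜ) h u p G o r)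
    (hineq : IneqAllQ G V r) : SwAll ends l h o :=
  swAll_of_reducible l h o hlh (hj.reducible_of_crossJunction' (by simp) hineq)

/-- **Row (SW) on every graph with a cross junction whose mark is a dropped vertex and whose cross
graph has the link inequality.** -/
theorem sw_of_crossJunctionQ' (hlh : l ≠ h) (hj : CrossJunctionQ ends ({l}ᶜ) h u p G o r)
    (hineq : IneqAllQ G V r) : Sw ends l h o :=
  sw_of_swAll ends (swAll_of_crossJunctionQ' hlh hj hineq)

end Any

section Connected

variable {ends : E → Sym2 V} {X : Type*} [Fintype X] [DecidableEq X] [Nonempty X]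
  {G : SimpleGraph X} [DecidableRel G.Adj] (hG : G.Connected) {U : Set V} {l h o u : V}
  {p : X → V} {r : X}
include hG

/-- The link record of a connected component has the inequality over every u-arm family. -/
theorem ineqAllQ_of_connected : IneqAllQ G V r := by
  intro S _ _ _ _ _
  convert ineqM_fibKEEQ G hG r (ι := {P // P ∈ S}) using 2

/-- **THEOREM A_cross WITH THE MARK AT A DROPPED VERTEX**: the rigid inequality on every class of
a cross junction (connected cross graph) whose mark is the dropped vertex `p r`, for every outside
colouring. -/
theorem CrossJunctionQ.rigidOK_of_crossJunctionQ (hj : CrossJunctionQ ends U h u p G o r)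
    (hl : l ∉ U) (ξ : Config E) : RigidOK ends l h o U ξ :=
  hj.rigidOK_of_crossJunction' hl (ineqAllQ_of_connected hG)

/-- **Row 2′SW-ALL on every graph with a cross junction whose mark is a dropped vertex.** -/
theorem swAll_of_crossJunctionQ (hlh : l ≠ h) (hj : CrossJunctionQ ends ({l}ᶜ) h u p G o r) :
    SwAll ends l h o :=
  swAll_of_crossJunctionQ' hlh hj (ineqAllQ_of_connected hG)

/-- **Row (SW) on every graph with a cross junction whose mark is a dropped vertex.** -/
theorem sw_of_crossJunctionQ (hlh : l ≠ h) (hj : CrossJunctionQ ends ({l}ᶜ) h u p G o r) :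
    Sw ends l h o :=
  sw_of_swAll ends (swAll_of_crossJunctionQ hG hlh hj)

end Connected

end CrossArm

end Summit.Ventures.PercRepro2
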